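import Summits.Ventures.DiscreteObjects.Hadamard.ConferenceGraph333

/-!
# srg(333,166,82,83) has no equitable partition into TWO cells: every automorphism group has one or ≥ 3 orbits (kernel)

Framing: lottery ticket; floor = certified bounds/negative ranges.  Cell pub-namedobj (venture DiscreteObjects),
target (H), hadamard gen 28; companion of `ConferenceGraph333ThreeCells` (no equitable partition into three cells
of size `111`).  Here the cell sizes are ARBITRARY but there are only two cells:
* **`seidel333_classSum_identities`** — for a Seidel matrix `S` of order `333` (`S² = 333·I − J`, zero row sums,
  symmetric) and ANY partition `cls : V → ι` that is equitable for `S` (cell sums `R(cls x, j)`), the class-sum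
  matrix satisfies `Σ_j R_{ij} = 0`, `Σ_j R_{ij} R_{jk} = 333·[i = k] − n_k` (`n_k` = size of cell `k`; the
  orbit-matrix identity of Behbahani–Lam 2011 / Crnković–Egan–Švob 2020 Thm 2.3 for Seidel matrices) and
  `n_i R_{ij} = n_j R_{ji}`;
* **`no_twoCells_seidel333`** — with exactly two cells (`|ι| = 2`, both nonempty) these give, writing
  `a = R₁₁ = −R₁₂` and `c = R₂₂ = −R₂₁`, `a(a + c) = n₂` and `c(a + c) = n₁`, so `(a + c)² = n₁ + n₂ = 333` — not a
  square.  Hence **`no_twoCells_srg333`** (adjacency form) and **`no_twoOrbits_srg333`**: no group of automorphisms of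
  an `srg(333,166,82,83)` has exactly two orbits on the vertices (whatever their sizes), i.e. `Aut` is transitive or
  has at least three orbits; the distance partition `{x} ∪ Γ(x) ∪ Γ₂(x)` shows that unequal three-cell equitable
  partitions are not excluded at this level, and `ConferenceGraph333ThreeCells` excludes the equal one.
Ours (instance; the method is the printed orbit-matrix method); `srg(333,166,82,83)`, `C(334)`, `H(668)` untouched.
No `sorry`, no new definitions.
-/

namespace Summit.Ventures.DiscreteObjects.Hadamard

open Finset

section seidel
variable {V ι : Type*} [Fintype V] [DecidableEq V] [Fintype ι] [DecidableEq ι]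

/-- **Class-sum (orbit-matrix) identities** for an equitable partition of a Seidel matrix of order `333`:
zero row sums, `Σ_j R_{ij} R_{jk} = 333·[i=k] − n_k`, and `n_i R_{ij} = n_j R_{ji}`. -/
theorem seidel333_classSum_identities (S : Matrix V V ℤ) (hSs : ∀ x y, S y x = S x y) (hS1 : ∀ x, ∑ y, S x y = 0)
    (hSS : ∀ x y, ∑ z, S x z * S z y = 333 * (if x = y then 1 else 0) - 1)
    (cls : V → ι) (R : ι → ι → ℤ) (hR : ∀ x j, ∑ y ∈ univ.filter (fun y => cls y = j), S x y = R (cls x) j)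
    (i k : ι) (x : V) (hx : cls x = i) :
    (∑ j, R i j = 0) ∧
    (∑ j, R i j * R j k = 333 * (if i = k then 1 else 0) - ((univ.filter fun y => cls y = k).card : ℤ)) ∧
    (((univ.filter fun y => cls y = i).card : ℤ) * R i k = ((univ.filter fun y => cls y = k).card : ℤ) * R k i) := by
  subst hx
  refine ⟨?_, ?_, ?_⟩
  · rw [← hS1 x, ← Finset.sum_fiberwise univ cls fun y => S x y]
    exact Finset.sum_congr rfl fun j _ => by rw [hR]
  · have h1 : ∀ j, R (cls x) j * R j k = ∑ z ∈ univ.filter (fun y => cls y = j), S x z * R (cls z) k := by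
      intro j
      rw [← hR x j, Finset.sum_mul]
      refine Finset.sum_congr rfl fun z hz => ?_
      rw [(Finset.mem_filter.mp hz).2]
    rw [Finset.sum_congr rfl fun j _ => h1 j, Finset.sum_fiberwise univ cls fun z => S x z * R (cls z) k]
    have h2 : ∀ z, S x z * R (cls z) k = ∑ y ∈ univ.filter (fun y => cls y = k), S x z * S z y := by
      intro z; rw [← hR z k, Finset.mul_sum]
    rw [Finset.sum_congr rfl fun z _ => h2 z, Finset.sum_comm]
    rw [Finset.sum_congr rfl fun y _ => hSS x y, Finset.sum_sub_distrib, ← Finset.mul_sum, Finset.sum_ite_eq,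
      Finset.sum_const]
    simp [Finset.mem_filter]
  · have hi : ∑ x' ∈ univ.filter (fun y => cls y = cls x), ∑ y ∈ univ.filter (fun y => cls y = k), S x' y =
        ((univ.filter fun y => cls y = cls x).card : ℤ) * R (cls x) k := by
      rw [Finset.sum_congr rfl fun x' hx' => by rw [hR x' k, (Finset.mem_filter.mp hx').2], Finset.sum_const]
      simp
    have hk : ∑ y ∈ univ.filter (fun y => cls y = k), ∑ x' ∈ univ.filter (fun y => cls y = cls x), S y x' =
        ((univ.filter fun y => cls y = k).card : ℤ) * R k (cls x) := by
      rw [Finset.sum_congr rfl fun y hy => by rw [hR y (cls x), (Finset.mem_filter.mp hy).2], Finset.sum_const]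
      simp
    rw [← hi, ← hk, Finset.sum_comm]
    exact Finset.sum_congr rfl fun y _ => Finset.sum_congr rfl fun x' _ => (hSs x' y).symm

/-- **No equitable two-partition of a Seidel matrix of order `333`.**  (`|ι| = 2`, both cells nonempty.) -/
theorem no_twoCells_seidel333 (hV : Fintype.card V = 333) (hι : Fintype.card ι = 2) (S : Matrix V V ℤ)
    (hSs : ∀ x y, S y x = S x y) (hS1 : ∀ x, ∑ y, S x y = 0)
    (hSS : ∀ x y, ∑ z, S x z * S z y = 333 * (if x = y then 1 else 0) - 1)
    (cls : V → ι) (hne : ∀ i, ∃ x, cls x = i)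
    (R : ι → ι → ℤ) (hR : ∀ x j, ∑ y ∈ univ.filter (fun y => cls y = j), S x y = R (cls x) j) : False := by
  choose rep hrep using hne
  obtain ⟨i₁, i₂, h12, huniv⟩ := Finset.card_eq_two.mp (show (univ : Finset ι).card = 2 by
    rw [Finset.card_univ, hι])
  have hsum2 : ∀ f : ι → ℤ, ∑ j, f j = f i₁ + f i₂ := fun f => by rw [huniv, Finset.sum_pair h12]
  -- cell sizes add up to 333
  have hn : ((univ.filter fun y => cls y = i₁).card : ℤ) + ((univ.filter fun y => cls y = i₂).card : ℤ) = 333 := by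
    have h := Finset.card_eq_sum_card_fiberwise (s := (univ : Finset V)) (t := (univ : Finset ι)) (f := cls)
      fun _ _ => Finset.mem_univ _
    rw [Finset.card_univ, hV] at h
    have h' : (333 : ℤ) = ∑ j, ((univ.filter fun y => cls y = j).card : ℤ) := by exact_mod_cast h
    rw [h', hsum2]
  obtain ⟨h1s, h1p, -⟩ := seidel333_classSum_identities S hSs hS1 hSS cls R hR i₁ i₂ (rep i₁) (hrep i₁)
  obtain ⟨h2s, h2p, -⟩ := seidel333_classSum_identities S hSs hS1 hSS cls R hR i₂ i₁ (rep i₂) (hrep i₂)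
  rw [hsum2] at h1s h1p h2s h2p
  simp only [h12, h12.symm, if_false, mul_zero, zero_sub] at h1p h2p
  -- a = R i₁ i₁, R i₁ i₂ = -a; c = R i₂ i₂, R i₂ i₁ = -c:  a(a+c) = n₂, c(a+c) = n₁ ⇒ (a+c)² = 333
  have e1 : R i₁ i₂ = -R i₁ i₁ := by linarith
  have e2 : R i₂ i₁ = -R i₂ i₂ := by linarith
  rw [e1] at h1p
  rw [e2] at h2p
  have hsq : (R i₁ i₁ + R i₂ i₂) * (R i₁ i₁ + R i₂ i₂) = 333 := by linear_combination -h1p - h2p + hn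
  have hb : -19 < R i₁ i₁ + R i₂ i₂ ∧ R i₁ i₁ + R i₂ i₂ < 19 := by constructor <;> nlinarith
  obtain ⟨hb1, hb2⟩ := hb
  generalize R i₁ i₁ + R i₂ i₂ = t at hsq hb1 hb2
  interval_cases t <;> omega

end seidel

/-! ## The strongly regular graph -/

section srg
variable {V ι : Type*} [Fintype V] [DecidableEq V] [Fintype ι] [DecidableEq ι]

/-- **`srg(333,166,82,83)` has no equitable partition into two nonempty cells** (`B(cls x, j)` = number of
neighbours of `x` in cell `j`). -/
theorem no_twoCells_srg333 (hV : Fintype.card V = 333) (hι : Fintype.card ι = 2) (A : Matrix V V ℤ)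
    (h01 : ∀ x y, A x y = 0 ∨ A x y = 1) (hsymm : ∀ x y, A y x = A x y) (hdiag : ∀ x, A x x = 0)
    (hk : ∀ x, ∑ y, A x y = 166) (hsrg : ∀ x y, ∑ z, A x z * A z y = 83 * (1 + (if x = y then 1 else 0)) - A x y)
    (cls : V → ι) (hne : ∀ i, ∃ x, cls x = i)
    (B : ι → ι → ℤ) (hB : ∀ x j, ∑ y ∈ univ.filter (fun y => cls y = j), A x y = B (cls x) j) : False := by
  obtain ⟨-, -, hSs, hS1, hSS⟩ := seidel_identities_of_conferenceGraph A h01 hsymm hdiag 83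
    (by rw [hV]; norm_num) (fun x => by rw [hk x]; norm_num) hsrg
  refine no_twoCells_seidel333 hV hι (fun x y => 1 - (if x = y then 1 else 0) - 2 * A x y) hSs hS1
    (fun x y => by rw [hSS x y, hV]; norm_num) cls hne
    (fun i j => ((univ.filter fun y => cls y = j).card : ℤ) - (if i = j then 1 else 0) - 2 * B i j) fun x j => ?_
  rw [Finset.sum_sub_distrib, Finset.sum_sub_distrib, Finset.sum_const, ← Finset.mul_sum, hB x j, Finset.sum_ite_eq]
  simp [Finset.mem_filter]

/-- **No group of automorphisms of `srg(333,166,82,83)` has exactly two orbits on the vertices.**  Stated with an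
invariant two-valued orbit labelling `cls` (both values taken) on which `Γ` is transitive cell-wise. -/
theorem no_twoOrbits_srg333 {Γ : Type*} [Group Γ] [MulAction Γ V] (hV : Fintype.card V = 333)
    (hι : Fintype.card ι = 2) (A : Matrix V V ℤ) (h01 : ∀ x y, A x y = 0 ∨ A x y = 1)
    (hsymm : ∀ x y, A y x = A x y) (hdiag : ∀ x, A x x = 0) (hk : ∀ x, ∑ y, A x y = 166)
    (hsrg : ∀ x y, ∑ z, A x z * A z y = 83 * (1 + (if x = y then 1 else 0)) - A x y)
    (hA : ∀ (γ : Γ) x y, A (γ • x) (γ • y) = A x y) (cls : V → ι) (hcls : ∀ (γ : Γ) x, cls (γ • x) = cls x)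
    (htrans : ∀ x x', cls x = cls x' → ∃ γ : Γ, γ • x = x') (hne : ∀ i, ∃ x, cls x = i) : False := by
  choose rep hrep using hne
  refine no_twoCells_srg333 hV hι A h01 hsymm hdiag hk hsrg cls (fun i => ⟨rep i, hrep i⟩)
    (fun i j => ∑ y ∈ univ.filter (fun y => cls y = j), A (rep i) y) fun x j => ?_
  obtain ⟨γ, hγ⟩ := htrans (rep (cls x)) x (hrep (cls x))
  have hx : rep (cls x) = γ⁻¹ • x := eq_inv_smul_iff.mpr hγ
  rw [Finset.sum_filter, Finset.sum_filter]
  refine Fintype.sum_equiv (MulAction.toPerm γ⁻¹) _ _ fun y => ?_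
  rw [MulAction.toPerm_apply, hcls, hx, hA]

end srg

end Summit.Ventures.DiscreteObjects.Hadamard
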